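import Summits.Ventures.QEC.CircuitDistance.PortZTable
import Summits.Ventures.QEC.CircuitDistance.SchedCleanCycle
import HarnessLib

/-!
# Q4 lane, ₛ-spine: the SHAPE checkers of the `X`/`Z` tables against a SCHEDULED cycle (`shapeₛ σ`), for any CNOT order
# (venture QEC, experiment cell CDX, seat qec-cdx-type-2; the row checkers of `PortXTable`/`PortZTable` re-pointed from `shape` to
# `shapeₛ σ`; nothing here asserts a value of `d_circ`)

The table FORMATS `XTable`/`ZTable` (rows `mu`, residual support, class, certificate per kind) and the CLASS checker
(`classRow`/`ClassCorrect`: table arithmetic against `H^X`/`H^Z` of `S.toCode`) are order-free and reused unchanged; only the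
SHAPE checker compares a row with a one-cycle simulation and must read the schedule: `XTable.shapeRowₛ σ S T k` compares with
`shapeₛ σ S (k.fault 1 0)` (`SchedCleanCycle.lean`), `XTable.ShapeCorrectₛ σ S T` = every listed kind passes; `Z` mirror; the
unpacking lemmas `shapeRowₛ_spec`; and the ANCHOR `shapeRowₛ sched204 = shapeRow` (so `bb144XTable_shapeCorrect` is the
`sched204` instance). The translation/representative lemmas of `PortXTable` (`mZ_of_table`, …) follow in the ₛ-file that ports
`PortTranslate`; the DATA for `sched345` is `SchedTablesBB144o345.lean`.
-/

namespace Summit.Ventures.QEC.CircuitDistance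

open Literature.InformationTheory.QuantumCodes

variable {ℓ m : ℕ} [NeZero ℓ] [NeZero m]

/-- SHAPE CORRECTNESS of one `X`-table row against the cycle of schedule `σ` (decidable: the one-cycle simulation `shapeₛ σ S` of
the kind's representative at base index `0`, cycle `1`; cf. `XTable.shapeRow`). -/
def XTable.shapeRowₛ (σ : SMSchedule) (S : SMCode ℓ m) (T : XTable ℓ m) (k : XKind) : Bool :=
  ((monoList ℓ m).all fun j => (shapeₛ σ S (k.fault 1 (0 : BB.Mono ℓ m))).mZ 1 j == decide (j ∈ T.muZ k)) &&
  ((monoList ℓ m).all fun a =>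
    ((shapeₛ σ S (k.fault 1 (0 : BB.Mono ℓ m))).frame.dataXb (.inl a) == decide (.inl a ∈ T.ex k)) &&
    ((shapeₛ σ S (k.fault 1 (0 : BB.Mono ℓ m))).frame.dataXb (.inr a) == decide (.inr a ∈ T.ex k)))

/-- SHAPE CORRECTNESS of an `X`-table for schedule `σ`: every listed kind's row. -/
def XTable.ShapeCorrectₛ (σ : SMSchedule) (S : SMCode ℓ m) (T : XTable ℓ m) : Prop := ∀ k ∈ XKind.all, T.shapeRowₛ σ S k = true

/-- SHAPE CORRECTNESS of one `Z`-table row against the cycle of schedule `σ` (cf. `ZTable.shapeRow`). -/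
def ZTable.shapeRowₛ (σ : SMSchedule) (S : SMCode ℓ m) (T : ZTable ℓ m) (k : ZKind) : Bool :=
  ((monoList ℓ m).all fun i => (shapeₛ σ S (k.fault 1 (0 : BB.Mono ℓ m))).mX 1 i == decide (i ∈ T.muX k)) &&
  ((monoList ℓ m).all fun a =>
    ((shapeₛ σ S (k.fault 1 (0 : BB.Mono ℓ m))).frame.dataZb (.inl a) == decide (.inl a ∈ T.ez k)) &&
    ((shapeₛ σ S (k.fault 1 (0 : BB.Mono ℓ m))).frame.dataZb (.inr a) == decide (.inr a ∈ T.ez k)))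

/-- SHAPE CORRECTNESS of a `Z`-table for schedule `σ`. -/
def ZTable.ShapeCorrectₛ (σ : SMSchedule) (S : SMCode ℓ m) (T : ZTable ℓ m) : Prop := ∀ k ∈ ZKind.all, T.shapeRowₛ σ S k = true

/-! ## Anchor: under print's order the ₛ-checkers ARE the landed checkers -/

/-- ANCHOR (`X` rows). -/
theorem XTable.shapeRowₛ_sched204 (S : SMCode ℓ m) (T : XTable ℓ m) (k : XKind) : T.shapeRowₛ sched204 S k = T.shapeRow S k := by
  unfold XTable.shapeRowₛ XTable.shapeRow; simp only [shapeₛ_sched204]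

/-- ANCHOR (`Z` rows). -/
theorem ZTable.shapeRowₛ_sched204 (S : SMCode ℓ m) (T : ZTable ℓ m) (k : ZKind) : T.shapeRowₛ sched204 S k = T.shapeRow S k := by
  unfold ZTable.shapeRowₛ ZTable.shapeRow; simp only [shapeₛ_sched204]

/-- ANCHOR (`X` table): `ShapeCorrectₛ sched204 ↔ ShapeCorrect`. -/
theorem XTable.shapeCorrectₛ_sched204_iff (S : SMCode ℓ m) (T : XTable ℓ m) : T.ShapeCorrectₛ sched204 S ↔ T.ShapeCorrect S := by
  unfold XTable.ShapeCorrectₛ XTable.ShapeCorrect; simp only [XTable.shapeRowₛ_sched204]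

/-- ANCHOR (`Z` table). -/
theorem ZTable.shapeCorrectₛ_sched204_iff (S : SMCode ℓ m) (T : ZTable ℓ m) : T.ShapeCorrectₛ sched204 S ↔ T.ShapeCorrect S := by
  unfold ZTable.ShapeCorrectₛ ZTable.ShapeCorrect; simp only [ZTable.shapeRowₛ_sched204]

/-! ## What a correct row says -/

/-- What a correct `X`-row says (cf. `XTable.shapeRow_spec`). -/
theorem XTable.shapeRowₛ_spec {σ : SMSchedule} {S : SMCode ℓ m} {T : XTable ℓ m} {k : XKind} (h : T.shapeRowₛ σ S k = true) :
    (∀ j, (shapeₛ σ S (k.fault 1 (0 : BB.Mono ℓ m))).mZ 1 j = decide (j ∈ T.muZ k)) ∧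
    (∀ q, (shapeₛ σ S (k.fault 1 (0 : BB.Mono ℓ m))).frame.dataXb q = decide (q ∈ T.ex k)) := by
  unfold XTable.shapeRowₛ at h
  simp only [Bool.and_eq_true, List.all_eq_true, beq_iff_eq] at h
  obtain ⟨h1, h2⟩ := h
  refine ⟨fun j => h1 j (mem_monoList j), fun q => ?_⟩
  rcases q with a | a
  · exact (h2 a (mem_monoList a)).1
  · exact (h2 a (mem_monoList a)).2

/-- What a correct `Z`-row says (cf. `ZTable.shapeRow_spec`). -/
theorem ZTable.shapeRowₛ_spec {σ : SMSchedule} {S : SMCode ℓ m} {T : ZTable ℓ m} {k : ZKind} (h : T.shapeRowₛ σ S k = true) :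
    (∀ i, (shapeₛ σ S (k.fault 1 (0 : BB.Mono ℓ m))).mX 1 i = decide (i ∈ T.muX k)) ∧
    (∀ q, (shapeₛ σ S (k.fault 1 (0 : BB.Mono ℓ m))).frame.dataZb q = decide (q ∈ T.ez k)) := by
  unfold ZTable.shapeRowₛ at h
  simp only [Bool.and_eq_true, List.all_eq_true, beq_iff_eq] at h
  obtain ⟨h1, h2⟩ := h
  refine ⟨fun i => h1 i (mem_monoList i), fun q => ?_⟩
  rcases q with a | a
  · exact (h2 a (mem_monoList a)).1
  · exact (h2 a (mem_monoList a)).2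

/-- `ζ`-bit of a representative under any schedule: only the `InitZ` kind, only on its own ancilla (cf. `ancZx_kind`). -/
theorem ancZx_kindₛ (σ : SMSchedule) (S : SMCode ℓ m) (k : XKind) (c : ℕ) (i j : BB.Mono ℓ m) :
    (shapeₛ σ S (k.fault c i)).frame.ancZx j = (decide (k = .initZ) && decide (j = i)) := by
  rw [shapeₛ_ancZx, XKind.cyc_fault]
  cases k with
  | cnot lay bc bt => simp [XKind.fault]
  | idle s => simp [XKind.fault]
  | initZ =>
    by_cases hj : j = i
    · subst hj; simp [XKind.fault]
    · simp [XKind.fault, hj, Ne.symm hj]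
  | measZ => simp [XKind.fault]

end Summit.Ventures.QEC.CircuitDistance
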